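import Mathlib
import Literature.MathematicalPhysics.StatisticalMechanics.Crystallization
import Literature.MathematicalPhysics.StatisticalMechanics.LennardJonesClusters
import Literature.MathematicalPhysics.StatisticalMechanics.PeriodicConfigurationSums
import Summits.AtomisticToContinuum.Crystallization.Theorems.ThreeConeCertificateExactCertificateTransfer1D
import Summits.AtomisticToContinuum.Crystallization.Theorems.ThreeConeCertificateExactCertificateTransfer1DEnergetic
import Summits.AtomisticToContinuum.Crystallization.Theorems.ThreeConeCertificateExactCertificateTransfer1DChainEnergy
import Summits.AtomisticToContinuum.Crystallization.Theorems.ThreeConeCertificateExactCertificateTransfer1DClassCrossing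
import Summits.AtomisticToContinuum.Crystallization.Theorems.ThreeConeCertificateExactCertificateTransfer1DClassPsiPosType
import Summits.AtomisticToContinuum.Crystallization.Theorems.ThreeConeCertificateExactCertificateTransfer1DClassPosType
import Summits.AtomisticToContinuum.Crystallization.Theorems.ThreeConeCertificateExactCertificateTransfer1DClassCore
import Summits.AtomisticToContinuum.Crystallization.Theorems.ThreeConeCertificateExactCertificateTransfer1DClassTail
import Summits.AtomisticToContinuum.Crystallization.Theorems.ThreeConeCertificateExactCertificateTransfer1DClassChain
import Summits.AtomisticToContinuum.Crystallization.Theorems.ThreeConeCertificateExactCertificateTransfer1DClassBounds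

/-!
# Crux `ExactCertificate` (stmt-AtomisticToContinuum-11959), line `closure-makes-nogap-exact`:
# TRANSFER V — the d = 1 exactness mechanism as a CLASS THEOREM (one-crossing Laplace densities)

Support file (`--supports stmt-AtomisticToContinuum-11959`); nothing here closes the 3-D crux, which stays
`NoGap ∧ KeplerBound` with `KeplerBound` = item 11961 ↔ 0627 (open).  This is the assembly of Transfer
skeleton V (`Cruxes/ExactCertificate/Lines/closure_makes_nogap_exact_class1d.lean`, deciding decl
`OneCrossingChainCertificate`), composing its eight landed stubs (`stub_classCrossing`, `stub_classPsiPosType`,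
`stub_classPosType`, `stub_classCore`, `stub_classTail`, `stub_classChain`, `stub_classBounds`; the eighth,
`stub_groundStateUnique`, is an independent rigidity statement).

## The class

A pair potential `V : ℝ → ℝ` is in the ONE-CROSSING LAPLACE CLASS when, on `(0,∞)`,
`V(r) = −∫₀^∞ e^{−tr} p(t) dt` for a measurable density `p` which is `≥ 0` on `(0, t₀]` and `≤ 0` on
`[t₀, ∞)` (ONE sign change: completely-monotone long-range ATTRACTION minus completely-monotone short-range
REPULSION whose Bernstein measure lies to the right of the attraction's) with a polynomial envelope
`|p(t)| ≤ C (t² + t^M)`, `M ≥ 2` (so `|V(r)| ≤ C(2r⁻³ + M! r^{−M−1})`: divergent-or-bounded core, `O(r⁻³)`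
tail, chain-summable).  Examples: every Mie potential `A r⁻ⁿ − B r⁻ᵐ` (`A, B > 0`, `n > m ≥ 3`;
`p(t) = B t^{m−1}/(m−1)! − A t^{n−1}/(n−1)!`), in particular `V_LJ = r⁻¹²/12 − r⁻⁶/6`
(companion file `…Transfer1DClassMie.lean`).  A spacing `a > 0` is at ZERO PRESSURE when the
`(k+1)`-weighted first moments vanish, `Σ_k (k+1) ∫₀^∞ e^{−t(k+1)a} p(t) t dt = 0`, i.e. `Σ_{m≥1} m V′(ma) = 0`:
the chain `aℤ` is in mechanical equilibrium.

## Results (all hypotheses explicit; `e_a := Σ_{m≥1} V(ma)`)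

* `oneCrossing_magic` — the ONE-DIMENSIONAL MAGIC FUNCTION of the class: at every zero-pressure spacing `a`
  the pair function `F_a = −¼Δ_aΨ_a` is of positive type on `ℝ¹`, lies below `V` on `(0,∞)`, equals `V`
  on `[a,∞)`, and `F_a(0) = −2e_a`; the chain `aℤ` (points `(ka)e₀`) has `e_V(aℤ) = e_a`.
* `exactCertificate_one_of_oneCrossing` — **THE CLASS CERTIFICATE**: the crux `ExactCertificate` VERBATIM
  with `3 ↦ 1` and `lennardJones ↦ V` (witness `P = aℤ`, `ρ = a`, `c = 0`, `g = V − F_a`, `U ≡ 0`,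
  `f = F_a`).  This is the registered deciding statement `OneCrossingChainCertificate` of skeleton V.
* `keplerBound_one_of_oneCrossing` — the SHARP Kepler bound `N·e_a ≤ E_V(x)` for every configuration of
  `N` distinct points of the line (optimal stability constant of the class = `−e_a`).
* `energyPerParticle_ge_of_oneCrossing` — `e_a ≤ e_V(Q)` for EVERY periodic configuration `Q` of `ℝ¹`
  (periodic Bochner inequality, no trial states); hence `chainEnergy_le_of_zeroPressure`: EVERY
  zero-pressure spacing is a GLOBAL minimiser of `b ↦ e_V(bℤ)` on `(0,∞)` — a critical point of the chain
  energy of a one-crossing potential is automatically its minimum.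
* `hasPeriodicGroundStateEnergy_one_of_oneCrossing` — **ENERGETIC CRYSTALLIZATION OF THE CLASS**:
  `HasPeriodicGroundStateEnergy V 1` (conjunct (i) of the summit sub-problem with `3 ↦ 1`,
  `lennardJones ↦ V`): `E(N)/N → min_Q e_V(Q) = e_V(aℤ)`.

## Why this is the crux's Transfer exhibit (STRATEGY-CENSUS §2a, sharpened)

c6 proved the Lennard-Jones case from the explicit density `t⁵/6! − t¹¹/12!`; the class theorem shows that
NOTHING about Lennard-Jones beyond ONE SIGN CHANGE of its Laplace density is used, and that zero pressure is
used exactly once (as the vanishing weighted first moment against which the antitone weights `Q(t)/t` and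
`−sinh(tu)/t` are tested).  The d = 1 mechanism is therefore "one crossing + a finite-range invisibility
operator (`−¼Δ_a`) with a retarded Green's function on a half-line"; d = 3 keeps the first factor
(`isOneCrossingMixture_lennardJones`, route OneCrossingRisingSea) and forbids the second (no finite-range
RADIAL invisibility operator: `O(K)` zeros of an entire function against `≍ K²` Bragg radii) — the far-field
wall W1 on which every 3-D line of this crux died.  Nearest print: Ventevogel 1978 / Ventevogel–Nijboer 1979
(convexity proof of the 1-D minimum for a class of potentials), Gardner–Radin 1979, Cohn–Kumar 2007 §9.
-/

noncomputable section

namespace Summit.AtomisticToContinuum.Crystallization.Theorems.ThreeConeCertificateExactCertificate.Transfer1D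

open Literature.MathematicalPhysics.StatisticalMechanics MeasureTheory Set Filter Topology
open scoped BigOperators

/-- **The one-dimensional magic function of a one-crossing potential.**  Let `V(r) = −∫₀^∞e^{−tr}p(t)dt` on
`(0,∞)` with `p` measurable, `p ≥ 0` on `(0,t₀]`, `p ≤ 0` on `[t₀,∞)`, `|p(t)| ≤ C(t² + t^M)` (`M ≥ 2`), and
let `a > 0` be at zero pressure (`Σ_k(k+1)∫₀^∞e^{−t(k+1)a}p(t)t dt = 0`).  Then there are a pair function `f`
(namely `F_a(x) = Σ_k(k+1)[V(|x+a|+(k+1)a) − 2V(|x|+(k+1)a) + V(|x−a|+(k+1)a)]`) and the chain `aℤ` as a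
periodic configuration `P` of `ℝ¹` (points `(ka)e₀`, `k ∈ ℤ`, with `e_V(P) = Σ_{m≥1}V(ma)`) such that `f` is of
positive type on `ℝ¹`, `f ≤ V` on `(0,∞)`, `f = V` on `[a,∞)` and `f(0) = −2Σ_{m≥1}V(ma) = −2e_V(P)`. [folklore] -/
theorem oneCrossing_magic {V p : ℝ → ℝ} {t₀ C a : ℝ} {M : ℕ} (hpm : Measurable p) (ht₀ : 0 < t₀)
    (hpos : ∀ t : ℝ, 0 < t → t ≤ t₀ → 0 ≤ p t) (hneg : ∀ t : ℝ, t₀ ≤ t → p t ≤ 0) (hM : 2 ≤ M)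
    (hbd : ∀ t : ℝ, 0 < t → |p t| ≤ C * (t ^ 2 + t ^ M))
    (hV : ∀ r : ℝ, 0 < r → V r = -(∫ t in Set.Ioi (0 : ℝ), Real.exp (-(t * r)) * p t))
    (ha : 0 < a)
    (hz : HasSum (fun k : ℕ => ((k : ℝ) + 1) *
      ∫ t in Set.Ioi (0 : ℝ), Real.exp (-(t * (((k : ℝ) + 1) * a))) * p t * t) 0) :
    ∃ (f : ℝ → ℝ) (P : PeriodicConfiguration 1) (e : ℤ ≃ P.points),
      (∀ k : ℤ, ((e k : P.points) : EuclideanSpace ℝ (Fin 1)) =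
        EuclideanSpace.single (0 : Fin 1) ((k : ℝ) * a)) ∧
      P.energyPerParticle V = ∑' k : ℕ, V (((k : ℝ) + 1) * a) ∧
      (∀ (n : ℕ) (y : Fin n → EuclideanSpace ℝ (Fin 1)) (w : Fin n → ℝ),
        0 ≤ ∑ i, ∑ j, w i * w j * f (dist (y i) (y j))) ∧
      (∀ r : ℝ, 0 < r → f r ≤ V r) ∧ (∀ r : ℝ, a ≤ r → f r = V r) ∧
      f 0 = -2 * ∑' k : ℕ, V (((k : ℝ) + 1) * a) := by
  obtain ⟨hint0, hint1, hsum1, hsum0⟩ := stub_classBounds V p C M hM hpm hbd hV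
  -- the single-crossing conclusion at `a`
  have hCR := stub_classCrossing p t₀ ht₀ hpos hneg a ha (fun k => hint1 _ (by positivity)) hz
  -- the chain `aℤ` and the telescoping identities
  have hs0 : Summable (fun k : ℕ => V (((k : ℝ) + 1) * a)) := by
    simpa only [zero_add] using hsum0 a ha 0 le_rfl
  obtain ⟨P, e, he, hP⟩ := stub_classChain V a ha hs0
  obtain ⟨htail, hF0⟩ := stub_classTail V a ha (hsum1 a ha) (hsum0 a ha)
  -- the tail interpolant `F_a`
  set Fa : ℝ → ℝ := fun x => ∑' k : ℕ, ((k : ℝ) + 1) * (V (|x + a| + ((k : ℝ) + 1) * a)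
      - 2 * V (|x| + ((k : ℝ) + 1) * a) + V (|x - a| + ((k : ℝ) + 1) * a)) with hFa
  have hFa_tail : ∀ x : ℝ, a ≤ x → Fa x = V x := fun x hx => htail x hx
  have hFa_zero : Fa 0 = -2 * ∑' k : ℕ, V (((k : ℝ) + 1) * a) := by
    rw [← hF0, hFa]
    simp only [zero_add, zero_sub, abs_neg, abs_zero, abs_of_pos ha]
  have hcore : ∀ r : ℝ, 0 < r → r < a → Fa r ≤ V r :=
    fun r hr hra => stub_classCore V p a ha hint0 hV (hsum1 a ha) hCR r hr hra
  have hposT : ∀ (n : ℕ) (y : Fin n → EuclideanSpace ℝ (Fin 1)) (w : Fin n → ℝ),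
      0 ≤ ∑ i, ∑ j, w i * w j * Fa (dist (y i) (y j)) :=
    stub_classPosType V a ha (hsum1 a ha)
      (stub_classPsiPosType stub_quadAntitone V p a ha hint0 hV (hsum1 a ha) hCR)
  refine ⟨Fa, P, e, he, hP, hposT, fun r hr => ?_, hFa_tail, hFa_zero⟩
  by_cases h : r < a
  · exact hcore r hr h
  · exact (hFa_tail r (not_lt.1 h)).le

/-! ## The class certificate (`OneCrossingChainCertificate`) -/

/-- **THE CLASS CERTIFICATE** — `ThreeConeCertificate.ExactCertificate` VERBATIM with `3 ↦ 1` and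
`lennardJones ↦ V`, for EVERY pair potential `V` of the one-crossing Laplace class at EVERY zero-pressure
spacing `a` (the registered deciding statement `OneCrossingChainCertificate` of Transfer skeleton V).  Witness:
`P = aℤ`, `ρ = a`, `c = 0`, `g = V − F_a` (vanishing on `[a,∞)`, non-negative on `(0,a)`), `U ≡ 0`,
`f = F_a` (`oneCrossing_magic`), `c + f(0)/2 = −e_V(aℤ)`. [folklore] -/
theorem exactCertificate_one_of_oneCrossing {V p : ℝ → ℝ} {t₀ C a : ℝ} {M : ℕ} (hpm : Measurable p)
    (ht₀ : 0 < t₀) (hpos : ∀ t : ℝ, 0 < t → t ≤ t₀ → 0 ≤ p t) (hneg : ∀ t : ℝ, t₀ ≤ t → p t ≤ 0)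
    (hM : 2 ≤ M) (hbd : ∀ t : ℝ, 0 < t → |p t| ≤ C * (t ^ 2 + t ^ M))
    (hV : ∀ r : ℝ, 0 < r → V r = -(∫ t in Set.Ioi (0 : ℝ), Real.exp (-(t * r)) * p t))
    (ha : 0 < a)
    (hz : HasSum (fun k : ℕ => ((k : ℝ) + 1) *
      ∫ t in Set.Ioi (0 : ℝ), Real.exp (-(t * (((k : ℝ) + 1) * a))) * p t * t) 0) :
    ∃ (P : PeriodicConfiguration 1) (ρ c : ℝ) (g U f : ℝ → ℝ),
      (∀ r : ℝ, 0 < r → V r = g r + U r + f r) ∧ (∀ r : ℝ, 0 < r → 0 ≤ U r) ∧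
      (∀ r : ℝ, ρ ≤ r → g r = 0) ∧
      (∀ (n : ℕ) (y : Fin n → EuclideanSpace ℝ (Fin 1)) (w : Fin n → ℝ),
        0 ≤ ∑ i, ∑ j, w i * w j * f (dist (y i) (y j))) ∧
      (∀ (N : ℕ) (x : Fin N → EuclideanSpace ℝ (Fin 1)), Function.Injective x →
        -(c * (N : ℝ)) ≤ interactionEnergy g x) ∧
      c + f 0 / 2 = -(P.energyPerParticle V) := by
  obtain ⟨f, P, -, -, hP, hposT, hle, htail, hf0⟩ :=
    oneCrossing_magic hpm ht₀ hpos hneg hM hbd hV ha hz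
  refine ⟨P, a, 0, fun r => V r - f r, fun _ => 0, f, fun r _ => by ring, fun _ _ => le_rfl,
    fun r hr => by show V r - f r = 0; rw [htail r hr, sub_self], hposT, fun N x hx => ?_,
    by rw [hP, hf0]; ring⟩
  -- `0`-stability of `g = V − f ≥ 0`, pair by pair
  rw [zero_mul, neg_zero]
  unfold interactionEnergy
  refine Finset.sum_nonneg fun i _ => Finset.sum_nonneg fun j hj => sub_nonneg.2 (hle _ ?_)
  exact dist_pos.2 fun heq => (Finset.mem_Ioi.1 hj).ne' (hx heq.symm)

/-- **Registered stub `stub_classAssembly` — the deciding statement `OneCrossingChainCertificate` of Transfer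
skeleton V** (the crux `ExactCertificate` with `3 ↦ 1`, `lennardJones ↦ V`, for every one-crossing Laplace-class
potential at every zero-pressure spacing), as a closed proposition: `exactCertificate_one_of_oneCrossing`. [folklore] -/
theorem stub_classAssembly : ∀ (V p : ℝ → ℝ) (t₀ C a : ℝ) (M : ℕ), Measurable p → 0 < t₀ →
    (∀ t : ℝ, 0 < t → t ≤ t₀ → 0 ≤ p t) → (∀ t : ℝ, t₀ ≤ t → p t ≤ 0) → 2 ≤ M →
    (∀ t : ℝ, 0 < t → |p t| ≤ C * (t ^ 2 + t ^ M)) →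
    (∀ r : ℝ, 0 < r → V r = -(∫ t in Set.Ioi (0 : ℝ), Real.exp (-(t * r)) * p t)) →
    0 < a →
    HasSum (fun k : ℕ => ((k : ℝ) + 1) *
      ∫ t in Set.Ioi (0 : ℝ), Real.exp (-(t * (((k : ℝ) + 1) * a))) * p t * t) 0 →
    ∃ (P : PeriodicConfiguration 1) (ρ c : ℝ) (g U f : ℝ → ℝ),
      (∀ r : ℝ, 0 < r → V r = g r + U r + f r) ∧ (∀ r : ℝ, 0 < r → 0 ≤ U r) ∧
      (∀ r : ℝ, ρ ≤ r → g r = 0) ∧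
      (∀ (n : ℕ) (y : Fin n → EuclideanSpace ℝ (Fin 1)) (w : Fin n → ℝ),
        0 ≤ ∑ i, ∑ j, w i * w j * f (dist (y i) (y j))) ∧
      (∀ (N : ℕ) (x : Fin N → EuclideanSpace ℝ (Fin 1)), Function.Injective x →
        -(c * (N : ℝ)) ≤ interactionEnergy g x) ∧
      c + f 0 / 2 = -(P.energyPerParticle V) :=
  fun _ _ _ _ _ _ hpm ht₀ hpos hneg hM hbd hV ha hz =>
    exactCertificate_one_of_oneCrossing hpm ht₀ hpos hneg hM hbd hV ha hz

/-! ## The sharp Kepler bound of the class -/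

/-- **The positive-type lower bound** (Bochner with unit weights): if `f` is of positive type on `ℝ¹` then
`−N f(0)/2 ≤ E_f(x)` for every configuration `x` of `N` points. [folklore] -/
theorem oneCrossing_posType_lower {f : ℝ → ℝ}
    (hposT : ∀ (n : ℕ) (y : Fin n → EuclideanSpace ℝ (Fin 1)) (w : Fin n → ℝ),
      0 ≤ ∑ i, ∑ j, w i * w j * f (dist (y i) (y j)))
    {N : ℕ} (x : Fin N → EuclideanSpace ℝ (Fin 1)) :
    -((N : ℝ) * f 0 / 2) ≤ interactionEnergy f x := by
  have h1 := hposT N x (fun _ => 1)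
  simp only [one_mul] at h1
  have h2 : ∑ i, ∑ j, f (dist (x i) (x j)) = N * f 0 + 2 * interactionEnergy f x := by
    rw [two_mul_interactionEnergy]
    have h : ∀ i : Fin N, ∑ j, f (dist (x i) (x j)) = f 0 + siteEnergy f x i := fun i => by
      rw [siteEnergy, ← Finset.add_sum_erase Finset.univ _ (Finset.mem_univ i), dist_self]
    simp only [h, Finset.sum_add_distrib, Finset.sum_const, Finset.card_univ, Fintype.card_fin,
      nsmul_eq_mul]
  rw [h2] at h1
  linarith

/-- **THE SHARP KEPLER BOUND OF THE CLASS.**  For a one-crossing potential `V` at a zero-pressure spacing `a`: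
`N · Σ_{m≥1}V(ma) ≤ E_V(x)` for every `N` and every configuration `x` of `N` distinct points of the line —
the energy per particle of the zero-pressure chain is the optimal stability constant
(`E_V ≥ E_{F_a} ≥ −N F_a(0)/2 = N e_a`). [folklore] -/
theorem keplerBound_one_of_oneCrossing {V p : ℝ → ℝ} {t₀ C a : ℝ} {M : ℕ} (hpm : Measurable p)
    (ht₀ : 0 < t₀) (hpos : ∀ t : ℝ, 0 < t → t ≤ t₀ → 0 ≤ p t) (hneg : ∀ t : ℝ, t₀ ≤ t → p t ≤ 0)
    (hM : 2 ≤ M) (hbd : ∀ t : ℝ, 0 < t → |p t| ≤ C * (t ^ 2 + t ^ M))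
    (hV : ∀ r : ℝ, 0 < r → V r = -(∫ t in Set.Ioi (0 : ℝ), Real.exp (-(t * r)) * p t))
    (ha : 0 < a)
    (hz : HasSum (fun k : ℕ => ((k : ℝ) + 1) *
      ∫ t in Set.Ioi (0 : ℝ), Real.exp (-(t * (((k : ℝ) + 1) * a))) * p t * t) 0)
    (N : ℕ) (x : Fin N → EuclideanSpace ℝ (Fin 1)) (hx : Function.Injective x) :
    (N : ℝ) * ∑' k : ℕ, V (((k : ℝ) + 1) * a) ≤ interactionEnergy V x := by
  obtain ⟨f, -, -, -, -, hposT, hle, -, hf0⟩ := oneCrossing_magic hpm ht₀ hpos hneg hM hbd hV ha hz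
  have hfE := oneCrossing_posType_lower hposT x
  have hVF : interactionEnergy f x ≤ interactionEnergy V x := by
    unfold interactionEnergy
    refine Finset.sum_le_sum fun i _ => Finset.sum_le_sum fun j hj => hle _ ?_
    exact dist_pos.2 fun heq => (Finset.mem_Ioi.1 hj).ne' (hx heq.symm)
  rw [hf0] at hfE
  linarith

/-! ## Periodic competitors: the zero-pressure chain is a periodic minimiser -/

/-- A one-crossing-class potential (indeed any `V` with `|V(r)| ≤ C(2r⁻³ + M!r^{−M−1})`) has absolutely
convergent lattice sums over every periodic configuration of `ℝ¹` (comparison with the Epstein-type sums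
`Σ |x − y|⁻³`, `Σ |x − y|^{−(M+1)}` of the tree). [folklore] -/
theorem oneCrossing_summable_periodic {V p : ℝ → ℝ} {C : ℝ} {M : ℕ} (hM : 2 ≤ M) (hpm : Measurable p)
    (hbd : ∀ t : ℝ, 0 < t → |p t| ≤ C * (t ^ 2 + t ^ M))
    (hV : ∀ r : ℝ, 0 < r → V r = -(∫ t in Set.Ioi (0 : ℝ), Real.exp (-(t * r)) * p t))
    (Q : PeriodicConfiguration 1) (y : EuclideanSpace ℝ (Fin 1)) :
    Summable (fun z : {z : EuclideanSpace ℝ (Fin 1) // z ∈ Q.points ∧ z ≠ y} => V (dist y z.1)) := by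
  have h3 := Q.summable_inv_pow_dist (n := 3) (by norm_num) y
  have hM1 := Q.summable_inv_pow_dist (n := M + 1) (show 1 < M + 1 by omega) y
  have hg : Summable (fun z : {z : EuclideanSpace ℝ (Fin 1) // z ∈ Q.points ∧ z ≠ y} =>
      C * (2 * (dist y z.1)⁻¹ ^ 3 + (M.factorial : ℝ) * (dist y z.1)⁻¹ ^ (M + 1))) :=
    ((h3.mul_left 2).add (hM1.mul_left _)).mul_left C
  refine Summable.of_norm_bounded hg fun z => ?_
  rw [Real.norm_eq_abs]
  exact classBounds_abs_le hpm hbd hV (dist_pos.2 fun h => z.2.2 h.symm)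

/-- **Every periodic competitor.**  For a one-crossing potential `V` at a zero-pressure spacing `a`:
`Σ_{m≥1}V(ma) ≤ e_V(Q)` for EVERY periodic configuration `Q` of `ℝ¹` — by the periodic Bochner inequality
`F_a(0)/2 + e_{F_a}(Q) ≥ 0` (`stub_periodicPosType1D`) and monotonicity `e_{F_a}(Q) ≤ e_V(Q)`; no trial states.
[folklore] -/
theorem energyPerParticle_ge_of_oneCrossing {V p : ℝ → ℝ} {t₀ C a : ℝ} {M : ℕ} (hpm : Measurable p)
    (ht₀ : 0 < t₀) (hpos : ∀ t : ℝ, 0 < t → t ≤ t₀ → 0 ≤ p t) (hneg : ∀ t : ℝ, t₀ ≤ t → p t ≤ 0)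
    (hM : 2 ≤ M) (hbd : ∀ t : ℝ, 0 < t → |p t| ≤ C * (t ^ 2 + t ^ M))
    (hV : ∀ r : ℝ, 0 < r → V r = -(∫ t in Set.Ioi (0 : ℝ), Real.exp (-(t * r)) * p t))
    (ha : 0 < a)
    (hz : HasSum (fun k : ℕ => ((k : ℝ) + 1) *
      ∫ t in Set.Ioi (0 : ℝ), Real.exp (-(t * (((k : ℝ) + 1) * a))) * p t * t) 0)
    (Q : PeriodicConfiguration 1) :
    ∑' k : ℕ, V (((k : ℝ) + 1) * a) ≤ Q.energyPerParticle V := by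
  obtain ⟨f, -, -, -, -, hposT, hle, htail, hf0⟩ := oneCrossing_magic hpm ht₀ hpos hneg hM hbd hV ha hz
  have hsV : ∀ y : EuclideanSpace ℝ (Fin 1), y ∈ Q.points →
      Summable (fun z : {z : EuclideanSpace ℝ (Fin 1) // z ∈ Q.points ∧ z ≠ y} => V (dist y z.1)) :=
    fun y _ => oneCrossing_summable_periodic hM hpm hbd hV Q y
  -- `f`-sites differ from `V`-sites only at the finitely many points within distance `a`
  have hsF : ∀ y : EuclideanSpace ℝ (Fin 1), y ∈ Q.points →
      Summable (fun z : {z : EuclideanSpace ℝ (Fin 1) // z ∈ Q.points ∧ z ≠ y} => f (dist y z.1)) := by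
    intro y hy
    have hfin : (Function.support fun z : {z : EuclideanSpace ℝ (Fin 1) // z ∈ Q.points ∧ z ≠ y} =>
        f (dist y z.1) - V (dist y z.1)).Finite := by
      have h1 := Q.finite_inter_points (Metric.isBounded_closedBall (x := y) (r := a))
      refine ((h1.preimage Subtype.val_injective.injOn)).subset fun z hz => ?_
      refine ⟨Metric.mem_closedBall'.2 ?_, z.2.1⟩
      by_contra hlt
      exact hz (show f (dist y z.1) - V (dist y z.1) = 0 by
        rw [htail _ (not_le.1 hlt).le, sub_self])
    have h2 : Summable (fun z : {z : EuclideanSpace ℝ (Fin 1) // z ∈ Q.points ∧ z ≠ y} =>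
        f (dist y z.1) - V (dist y z.1)) := summable_of_hasFiniteSupport hfin
    simpa using h2.add (hsV y hy)
  have hB := stub_periodicPosType1D stub_latticeGenerator1D stub_cesaro Q f hposT hsF
  have hmono : Q.energyPerParticle f ≤ Q.energyPerParticle V := by
    unfold PeriodicConfiguration.energyPerParticle
    refine mul_le_mul_of_nonneg_left (Finset.sum_le_sum fun y hy => ?_) (by positivity)
    have hyP := Q.mem_points_of_mem_motif hy
    exact (hsF y hyP).tsum_le_tsum (fun z => hle _ (dist_pos.2 fun h => z.2.2 h.symm)) (hsV y hyP)
  rw [hf0] at hB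
  linarith

/-- **A critical point of the chain energy is its global minimum.**  For a one-crossing potential, EVERY
zero-pressure spacing `a` minimises the chain energy `b ↦ Σ_{m≥1}V(mb)` over all `b > 0` (take `Q = bℤ` in
`energyPerParticle_ge_of_oneCrossing`); in particular two zero-pressure spacings have the same chain energy.
[folklore] -/
theorem chainEnergy_le_of_zeroPressure {V p : ℝ → ℝ} {t₀ C a : ℝ} {M : ℕ} (hpm : Measurable p)
    (ht₀ : 0 < t₀) (hpos : ∀ t : ℝ, 0 < t → t ≤ t₀ → 0 ≤ p t) (hneg : ∀ t : ℝ, t₀ ≤ t → p t ≤ 0)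
    (hM : 2 ≤ M) (hbd : ∀ t : ℝ, 0 < t → |p t| ≤ C * (t ^ 2 + t ^ M))
    (hV : ∀ r : ℝ, 0 < r → V r = -(∫ t in Set.Ioi (0 : ℝ), Real.exp (-(t * r)) * p t))
    (ha : 0 < a)
    (hz : HasSum (fun k : ℕ => ((k : ℝ) + 1) *
      ∫ t in Set.Ioi (0 : ℝ), Real.exp (-(t * (((k : ℝ) + 1) * a))) * p t * t) 0)
    {b : ℝ} (hb : 0 < b) :
    ∑' k : ℕ, V (((k : ℝ) + 1) * a) ≤ ∑' k : ℕ, V (((k : ℝ) + 1) * b) := by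
  obtain ⟨-, -, -, hsum0⟩ := stub_classBounds V p C M hM hpm hbd hV
  have hsb : Summable (fun k : ℕ => V (((k : ℝ) + 1) * b)) := by
    simpa only [zero_add] using hsum0 b hb 0 le_rfl
  obtain ⟨Q, -, -, hQ⟩ := stub_classChain V b hb hsb
  rw [← hQ]
  exact energyPerParticle_ge_of_oneCrossing hpm ht₀ hpos hneg hM hbd hV ha hz Q

/-! ## Energetic crystallization of the class -/

/-- **The chain as a trial state.**  The `V`-energy of `N` equally spaced points `(ia)e₀`, `i < N`, is
`Σ_{d<N}(N − d)φ(d)` with `φ(0) = 0`, `φ(d) = V(da)` (`d ≥ 1`): there are `N − d` pairs at index distance `d`.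
[folklore] -/
theorem oneCrossing_chain_interactionEnergy (V : ℝ → ℝ) {a : ℝ} (ha : 0 < a) (N : ℕ) :
    interactionEnergy V (fun i : Fin N => EuclideanSpace.single (0 : Fin 1) ((i : ℝ) * a)) =
      ∑ d ∈ Finset.range N, ((N : ℝ) - d) * (if d = 0 then 0 else V (d * a)) := by
  rw [← chainEnergy_sum_pairs (fun d : ℕ => if d = 0 then 0 else V (d * a)) (if_pos rfl) N]
  unfold interactionEnergy
  refine Finset.sum_congr rfl fun i _ => Finset.sum_congr rfl fun j hj => ?_
  have hij : i < j := Finset.mem_Ioi.1 hj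
  have hij' : (i : ℕ) < (j : ℕ) := hij
  have hne : (j : ℕ) - (i : ℕ) ≠ 0 := by omega
  rw [if_neg hne, PiLp.dist_single_same, Real.dist_eq, Nat.cast_sub hij'.le]
  congr 1
  rw [abs_of_neg (by nlinarith [show ((i : ℕ) : ℝ) < ((j : ℕ) : ℝ) by exact_mod_cast hij'])]
  ring

/-- The equally spaced configuration is injective for `a > 0`. [folklore] -/
theorem oneCrossing_chain_injective {a : ℝ} (ha : 0 < a) (N : ℕ) :
    Function.Injective (fun i : Fin N => EuclideanSpace.single (0 : Fin 1) ((i : ℝ) * a)) := by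
  intro i j h
  have h0 := congrArg (fun v : EuclideanSpace ℝ (Fin 1) => v 0) h
  simp only [PiLp.single_apply, if_true] at h0
  exact Fin.ext (Nat.cast_injective (R := ℝ) (mul_right_cancel₀ ha.ne' h0))

/-- **ENERGETIC CRYSTALLIZATION OF THE ONE-CROSSING CLASS.**  For a pair potential `V` of the one-crossing
Laplace class admitting a zero-pressure spacing `a`: `HasPeriodicGroundStateEnergy V 1` — the ground-state
energy per particle `E(N)/N` of `N` `V`-particles on a line converges to the MINIMUM of the energy per particle
over all periodic configurations of `ℝ¹`, attained at the chain `aℤ` (conjunct (i) of the summit sub-problem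
`Crystallization` with `3 ↦ 1`, `lennardJones ↦ V`).  Lower bounds from the certificate (Kepler bound for finite
`N`, periodic Bochner for periodic competitors), upper bound from the equally spaced trial state and a Cesàro
limit. [folklore] -/
theorem hasPeriodicGroundStateEnergy_one_of_oneCrossing {V p : ℝ → ℝ} {t₀ C a : ℝ} {M : ℕ}
    (hpm : Measurable p) (ht₀ : 0 < t₀) (hpos : ∀ t : ℝ, 0 < t → t ≤ t₀ → 0 ≤ p t)
    (hneg : ∀ t : ℝ, t₀ ≤ t → p t ≤ 0) (hM : 2 ≤ M) (hbd : ∀ t : ℝ, 0 < t → |p t| ≤ C * (t ^ 2 + t ^ M))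
    (hV : ∀ r : ℝ, 0 < r → V r = -(∫ t in Set.Ioi (0 : ℝ), Real.exp (-(t * r)) * p t))
    (ha : 0 < a)
    (hz : HasSum (fun k : ℕ => ((k : ℝ) + 1) *
      ∫ t in Set.Ioi (0 : ℝ), Real.exp (-(t * (((k : ℝ) + 1) * a))) * p t * t) 0) :
    HasPeriodicGroundStateEnergy V 1 := by
  obtain ⟨f, P, -, -, hP, -, -, -, -⟩ := oneCrossing_magic hpm ht₀ hpos hneg hM hbd hV ha hz
  have hkep := keplerBound_one_of_oneCrossing hpm ht₀ hpos hneg hM hbd hV ha hz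
  set eA : ℝ := ∑' k : ℕ, V (((k : ℝ) + 1) * a) with heA
  -- (1) `e(P) ≤ e(Q)` for every periodic `Q`
  have hleast : ∀ Q : PeriodicConfiguration 1, P.energyPerParticle V ≤ Q.energyPerParticle V :=
    fun Q => hP ▸ energyPerParticle_ge_of_oneCrossing hpm ht₀ hpos hneg hM hbd hV ha hz Q
  -- (2) lower bound for finite `N`: the Kepler bound
  have hlower : ∀ N : ℕ, 0 < N → P.energyPerParticle V ≤ groundStateEnergy V 1 N / N := by
    intro N hN
    have hNr : (0 : ℝ) < N := by exact_mod_cast hN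
    rw [le_div_iff₀ hNr, mul_comm, hP]
    haveI : Nonempty {x : Fin N → EuclideanSpace ℝ (Fin 1) // Function.Injective x} :=
      let ⟨x, hx⟩ := nonempty_injective_config (d := 1) one_pos N; ⟨⟨x, hx⟩⟩
    exact le_ciInf fun x => hkep N x.1 x.2
  -- (3) upper bound: the equally spaced trial state
  set φ : ℕ → ℝ := fun d => if d = 0 then 0 else V (d * a) with hφ
  have hφs : Summable φ := by
    obtain ⟨-, -, -, hsum0⟩ := stub_classBounds V p C M hM hpm hbd hV
    have hs0 : Summable (fun k : ℕ => V (((k : ℝ) + 1) * a)) := by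
      simpa only [zero_add] using hsum0 a ha 0 le_rfl
    refine (summable_nat_add_iff 1).1 (hs0.congr fun k => ?_)
    show V (((k : ℝ) + 1) * a) = (if k + 1 = 0 then 0 else V (((k + 1 : ℕ) : ℝ) * a))
    rw [if_neg (Nat.succ_ne_zero k), Nat.cast_add, Nat.cast_one]
  have hφt : ∑' d : ℕ, φ d = eA := by
    rw [hφs.tsum_eq_zero_add]
    have h0 : φ 0 = 0 := if_pos rfl
    have h1 : ∀ d : ℕ, φ (d + 1) = V (((d : ℝ) + 1) * a) := fun d => by
      show (if d + 1 = 0 then 0 else V (((d + 1 : ℕ) : ℝ) * a)) = V (((d : ℝ) + 1) * a)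
      rw [if_neg (Nat.succ_ne_zero d), Nat.cast_add, Nat.cast_one]
    rw [h0, zero_add, tsum_congr h1]
  have hupper : ∀ N : ℕ, 0 < N → groundStateEnergy V 1 N / N ≤
      (∑ d ∈ Finset.range N, ((N : ℝ) - d) * φ d) / N := by
    intro N hN
    have hNr : (0 : ℝ) < N := by exact_mod_cast hN
    refine div_le_div_of_nonneg_right ?_ hNr.le
    rw [← oneCrossing_chain_interactionEnergy V ha N]
    refine groundStateEnergy_le V ⟨(N : ℝ) * eA, ?_⟩ (oneCrossing_chain_injective ha N)
    rintro _ ⟨x, rfl⟩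
    exact hkep N x.1 x.2
  have hces := stub_cesaro φ hφs
  rw [hφt] at hces
  -- assemble
  refine ⟨P, ⟨⟨P, rfl⟩, ?_⟩, ?_⟩
  · rintro _ ⟨Q, rfl⟩
    exact hleast Q
  · rw [hP]
    refine tendsto_of_tendsto_of_tendsto_of_le_of_le' tendsto_const_nhds hces ?_ ?_
    · filter_upwards [eventually_gt_atTop 0] with N hN
      exact hP ▸ hlower N hN
    · filter_upwards [eventually_gt_atTop 0] with N hN
      exact hupper N hN

end Summit.AtomisticToContinuum.Crystallization.Theorems.ThreeConeCertificateExactCertificate.Transfer1D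

end
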